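import Literature.Topology.FourManifolds.FreeFundamentalGroupThreeManifoldProofs
import Literature.Topology.FourManifolds.OneOneHandlebodyBoundary
import Literature.Topology.FourManifolds.OrientedConnectedSumExistence
import Literature.Topology.FourManifolds.ConnectedSumPieceTransportCrossModel
import Literature.Topology.FourManifolds.SmoothOrientationSphereProofs
import Literature.Topology.FourManifolds.SphereTwoProdCircleSumFundamentalGroup
import Literature.Topology.FourManifolds.SphereTwoProdCircleSumUniqueness
import HarnessLib

/-!
# `#ᵏ(S¹ × S²)` from free `π₁`: the named fact is EQUIVALENT to Hempel's Thm. 5.3 with Perelman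

Topic `Literature/Topology/FourManifolds`; second proofs companion of
`FreeFundamentalGroupThreeManifold.lean` (named fact
`Literature.Topology.FourManifolds.diffeomorph_sumS1S2_of_isFreeOfRank_fundamentalGroup`:
a closed connected orientable smooth `3`-manifold with `π₁` free of rank `k` is diffeomorphic to
the boundary of every compact connected orientable `4`-dimensional `1`-handlebody of type `(1, k)`;
Abrams–Gay–Kirby (2018), p. 4; Hempel (1976), 5.3), after `FreeFundamentalGroupThreeManifoldProofs.lean`
whose §8 proves the fact, in every universe, FROM

> (H53) a closed connected orientable smooth `3`-manifold `M : Type` with `π₁(M, x)` free of rank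
> `k` satisfies `IsSphereTwoProdCircleSum k M` ("`M ≅ #ᵏ(S² × S¹)`" in the tree's honest
> connected-sum vocabulary of `KirbyCalculus.lean`)

— Hempel's Thm. 5.3 for closed orientable manifolds (Kneser's conjecture 7.1, prime decomposition
3.15, Thm. 5.2) with Perelman's theorem (Morgan–Tian (2007), Cor. 0.2 (a)) for the homotopy-sphere
summand.  This file proves the CONVERSE, so that **the named fact is equivalent to (H53)**
(`diffeomorph_sumS1S2_of_isFreeOfRank_fundamentalGroup_iff_hempel`), i.e. its residual debt is
exactly Hempel 5.3 + Perelman over `Type`, with no `4`-manifold and no well-definedness issue left: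

* §1 `IsSphereTwoProdCircleSum.of_diffeomorph` — transport along diffeomorphisms of the total
  space (`IsConnectedSum.of_diffeomorph`).
* §2 `exists_isSphereTwoProdCircleSum_closed` — **closed connected orientable models
  `W_k ≅ #ᵏ(S² × S¹)` charted on `ℝ³` exist for every `k`**: `W₀ = S³` (orientable,
  `isOrientable_sphere_holds`); `W_{k+1}` is an oriented connected sum of `W_k` with the boundary
  `B` of a compact connected orientable `(1,1)`-handlebody (`exists_oneHandlebody_four 1`; `B` is a
  closed connected orientable `3`-manifold charted on `ℝ³`, `FreeFundamentalGroupThreeManifoldProofs`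
  §4, and `B ≅ S² × S¹` with Mathlib's product model, Kirby (1989), Ch. I §2, p. 8, `k = 1`:
  `nonempty_diffeomorph_boundary_sphereTwo_prod_of_handleCount_one_one_holds`,
  `OneOneHandlebodyBoundary.lean`), which exists and is closed and oriented
  (`exists_isOrientedConnectedSum_holds`, Kervaire–Milnor §2), and is a connected sum
  `W_k # (S² × S¹)` with the PRODUCT-model summand by the cross-model transport
  `IsConnectedSum.of_diffeomorph_right'` (`ConnectedSumPieceTransportCrossModel.lean`).
* §3 `isSphereTwoProdCircleSum_of_classification` — the classification over `Type` ("closed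
  connected orientable `3`-manifolds with `π₁` free of equal rank are diffeomorphic") implies
  (H53): compare `M` with `W_k` (`π₁(W_k) ≅ F_k`, `IsSphereTwoProdCircleSum.nonempty_mulEquiv_freeGroup`)
  and transport.  With the universe RAISING `nonempty_diffeomorph_of_isFreeOfRank_of_univ`
  (`ULift`, `ManifoldULift`) and §5 of the proofs companion, the fact in any universe implies (H53).
* §4 `diffeomorph_sumS1S2_of_isFreeOfRank_fundamentalGroup_iff_hempel` — **the named fact (any
  universe) ⟺ (H53)**; and (H53) ⟺ the classification over `Type`
  (`hempel_iff_classification`).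

Everything is proved; no definition and no named fact is introduced; nothing is discharged (both
sides contain Perelman's theorem: `nonempty_diffeomorph_sphere_three_of_hempel`,
`nonempty_diffeomorph_sphere_three_of_diffeomorph_sumS1S2`).

## References

* J. Hempel, *3-Manifolds*, Ann. of Math. Studies 86 (1976), Thm. 5.2, 5.3, Thm. 7.1, Ch. 3.
  [Hempel1976]
* A. Abrams, D. Gay, R. Kirby, *Group trisections and smooth 4-manifolds*, Geom. Topol. 22
  (2018), p. 4 (proof of Thm. 5). [AbramsGayKirby2018]
* J. Morgan, G. Tian, *Ricci flow and the Poincaré conjecture* (2007), Cor. 0.2 (a). [MorganTian2007]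
* R. C. Kirby, *The topology of 4-manifolds*, LNM 1374 (1989), Ch. I §2, p. 8. [Kirby1989]
* M. Kervaire, J. Milnor, *Groups of homotopy spheres I*, Ann. of Math. 77 (1963), §2.
  [KervaireMilnorAnnals1963]
-/

open scoped Manifold ContDiff Topology
open Set Function Metric Module

noncomputable section

namespace Literature.Topology.FourManifolds

universe u

/-! ### §1 Transport of `IsSphereTwoProdCircleSum` along diffeomorphisms -/

/-- `IsSphereTwoProdCircleSum k` is invariant under diffeomorphisms onto a `C^∞` manifold
(compose for `k = 0`; transport the top gluing, `IsConnectedSum.of_diffeomorph`, for `k + 1`).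
[folklore] -/
theorem IsSphereTwoProdCircleSum.of_diffeomorph {k : ℕ} {P : Type} [TopologicalSpace P]
    [ChartedSpace (EuclideanSpace ℝ (Fin 3)) P] (h : IsSphereTwoProdCircleSum k P)
    {P' : Type} [TopologicalSpace P'] [ChartedSpace (EuclideanSpace ℝ (Fin 3)) P']
    [IsManifold (𝓡 3) ∞ P'] (e : P ≃ₘ⟮𝓡 3, 𝓡 3⟯ P') : IsSphereTwoProdCircleSum k P' := by
  cases k with
  | zero =>
    obtain ⟨f⟩ := (isSphereTwoProdCircleSum_zero_iff P).1 h
    exact (isSphereTwoProdCircleSum_zero_iff P').2 ⟨e.symm.trans f⟩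
  | succ k =>
    obtain ⟨Y, _, _, _, _, hY, hsum⟩ := (isSphereTwoProdCircleSum_succ_iff k P).1 h
    exact (isSphereTwoProdCircleSum_succ_iff k P').2
      ⟨Y, ‹_›, ‹_›, ‹_›, ‹_›, hY, hsum.of_diffeomorph e⟩

/-! ### §2 Closed connected orientable models of `#ᵏ(S² × S¹)` charted on `ℝ³` -/

/-- **For every `k` there is a closed connected orientable smooth `3`-manifold `W : Type`, charted
on `ℝ³`, with `IsSphereTwoProdCircleSum k W`.**  Induction: `W₀ = S³` (`isOrientable_sphere_holds`);
given `W_k` with an orientation, let `B` be the boundary of a compact connected orientable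
`4`-dimensional `(1,1)`-handlebody (`exists_oneHandlebody_four 1`, canonical boundary datum): a
closed connected orientable `3`-manifold charted on `ℝ³` (`connectedSpace_boundary_of_handleCount_one`,
`BoundaryData.isOrientable_carrier`) diffeomorphic to Mathlib's `S² × S¹` with the product model
(Kirby (1989), Ch. I §2, p. 8, `k = 1`:
`nonempty_diffeomorph_boundary_sphereTwo_prod_of_handleCount_one_one_holds`).  The oriented
connected sum `P = W_k # B` exists and is closed and oriented (`exists_isOrientedConnectedSum_holds`;
Kervaire–Milnor (1963), §2), it is a connected sum `W_k # (S² × S¹)` with the product-model summand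
(`IsConnectedSum.of_diffeomorph_right'`), hence `IsSphereTwoProdCircleSum (k + 1) P`, and it is
connected (`IsSphereTwoProdCircleSum.pathConnectedSpace`). [cite: Kirby1989, Ch. I §2 (p. 8)]
[cite: KervaireMilnorAnnals1963, §2, Lemma 2.1 (p. 505)] -/
theorem exists_isSphereTwoProdCircleSum_closed (k : ℕ) :
    ∃ (W : Type) (_ : TopologicalSpace W) (_ : T2Space W) (_ : SecondCountableTopology W)
      (_ : ChartedSpace (EuclideanSpace ℝ (Fin 3)) W) (_ : IsManifold (𝓡 3) ∞ W)
      (_ : CompactSpace W) (_ : ConnectedSpace W),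
      IsOrientable (𝓡 3) W ∧ IsSphereTwoProdCircleSum k W := by
  induction k with
  | zero =>
    haveI : ConnectedSpace (Metric.sphere (0 : EuclideanSpace ℝ (Fin 4)) 1) := by
      refine isConnected_iff_connectedSpace.mp (isConnected_sphere ?_ 0 zero_le_one)
      rw [← Module.finrank_eq_rank, finrank_euclideanSpace_fin]
      norm_num
    exact ⟨Metric.sphere (0 : EuclideanSpace ℝ (Fin 4)) 1, inferInstance, inferInstance,
      inferInstance, inferInstance, inferInstance, inferInstance, inferInstance,
      isOrientable_sphere_holds 3,
      (isSphereTwoProdCircleSum_zero_iff _).2 ⟨Diffeomorph.refl (𝓡 3) _ ∞⟩⟩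
  | succ k ih =>
    obtain ⟨W, _, _, _, _, _, _, _, hWo, hW⟩ := ih
    -- `B = ∂V`, `V` a compact connected orientable `(1,1)`-handlebody: a copy of `S² × S¹` on `ℝ³`
    obtain ⟨V, _, _, _, _, _, _, _, hVo, hV, -⟩ := exists_oneHandlebody_four 1
    let b : BoundaryData (𝓡∂ 4) V (𝓡 3) := BoundaryManifold.boundaryData 3 V
    haveI : T2Space b.carrier := b.t2Space_carrier
    haveI : SecondCountableTopology b.carrier := b.secondCountableTopology_carrier
    haveI : CompactSpace b.carrier := b.compactSpace_carrier
    haveI : ConnectedSpace b.carrier := connectedSpace_boundary_of_handleCount_one hV b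
    obtain ⟨e⟩ := nonempty_diffeomorph_boundary_sphereTwo_prod_of_handleCount_one_one_holds V hV
      hVo b
    obtain ⟨oW⟩ := hWo
    obtain ⟨oB⟩ := b.isOrientable_carrier hVo
    -- the oriented connected sum `P = W # B`
    obtain ⟨P, _, _, _, _, _, _, oP, hP⟩ :=
      exists_isOrientedConnectedSum_holds (n := 3) (by norm_num) W b.carrier oW oB
    have hsum : IsConnectedSum (𝓡 3) (𝓡 3) (𝓡 3) W b.carrier P := hP.isConnectedSum
    -- … is a connected sum `W # (S² × S¹)` with the product-model summand
    obtain ⟨Λ, -, -, -, -⟩ := exists_split_reflection_three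
    have hsum' : IsConnectedSum (𝓡 3) (𝓡 3) ((𝓡 2).prod (𝓡 1)) W
        (Metric.sphere (0 : EuclideanSpace ℝ (Fin 3)) 1 ×
          Metric.sphere (0 : EuclideanSpace ℝ (Fin 2)) 1) P :=
      hsum.of_diffeomorph_right' e rfl Λ
    have hP' : IsSphereTwoProdCircleSum (k + 1) P :=
      (isSphereTwoProdCircleSum_succ_iff k P).2 ⟨W, ‹_›, ‹_›, ‹_›, ‹_›, hW, hsum'⟩
    haveI : PathConnectedSpace P := hP'.pathConnectedSpace
    exact ⟨P, inferInstance, inferInstance, inferInstance, inferInstance, inferInstance,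
      inferInstance, inferInstance, ⟨oP⟩, hP'⟩

/-- **In particular (H53) is not vacuous**: for every `k` there is a closed connected orientable
smooth `3`-manifold `W : Type` with `π₁(W, w)` free of rank `k` and `IsSphereTwoProdCircleSum k W`
(`π₁(#ᵏ(S² × S¹)) ≅ F_k`, `IsSphereTwoProdCircleSum.nonempty_mulEquiv_freeGroup`;
Gompf–Scharlemann–Thompson (2010), §7). [folklore] -/
theorem exists_isFreeOfRank_isSphereTwoProdCircleSum (k : ℕ) :
    ∃ (W : Type) (_ : TopologicalSpace W) (_ : T2Space W) (_ : SecondCountableTopology W)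
      (_ : ChartedSpace (EuclideanSpace ℝ (Fin 3)) W) (_ : IsManifold (𝓡 3) ∞ W)
      (_ : CompactSpace W) (_ : ConnectedSpace W) (w : W),
      IsOrientable (𝓡 3) W ∧ IsFreeOfRank (FundamentalGroup W w) k ∧
        IsSphereTwoProdCircleSum k W := by
  obtain ⟨W, _, _, _, _, _, _, _, hWo, hW⟩ := exists_isSphereTwoProdCircleSum_closed k
  obtain ⟨w⟩ : Nonempty W := inferInstance
  obtain ⟨f⟩ := hW.nonempty_mulEquiv_freeGroup w
  exact ⟨W, inferInstance, inferInstance, inferInstance, inferInstance, inferInstance,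
    inferInstance, inferInstance, w, hWo, ⟨f.symm⟩, hW⟩

/-! ### §3 The classification over `Type` implies (H53); universe raising -/

/-- **Closed connected orientable `3`-manifolds with `π₁` free of equal rank are diffeomorphic
(over `Type`) ⟹ (H53)**: compare `M` with the model `W_k` of §2 and transport
`IsSphereTwoProdCircleSum k` along the diffeomorphism. [cite: Hempel1976, Thm. 5.3] -/
theorem isSphereTwoProdCircleSum_of_classification
    (h : ∀ (k : ℕ) (Y : Type) [TopologicalSpace Y] [T2Space Y] [SecondCountableTopology Y]
      [ChartedSpace (EuclideanSpace ℝ (Fin 3)) Y] [IsManifold (𝓡 3) ∞ Y] [CompactSpace Y]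
      [ConnectedSpace Y] (_ : IsOrientable (𝓡 3) Y) (y : Y)
      (_ : IsFreeOfRank (FundamentalGroup Y y) k)
      (Y' : Type) [TopologicalSpace Y'] [T2Space Y'] [SecondCountableTopology Y']
      [ChartedSpace (EuclideanSpace ℝ (Fin 3)) Y'] [IsManifold (𝓡 3) ∞ Y'] [CompactSpace Y']
      [ConnectedSpace Y'] (_ : IsOrientable (𝓡 3) Y') (y' : Y')
      (_ : IsFreeOfRank (FundamentalGroup Y' y') k), Nonempty (Y ≃ₘ⟮𝓡 3, 𝓡 3⟯ Y')) (k : ℕ)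
    (M : Type) [TopologicalSpace M] [T2Space M] [SecondCountableTopology M]
    [ChartedSpace (EuclideanSpace ℝ (Fin 3)) M] [IsManifold (𝓡 3) ∞ M] [CompactSpace M]
    [ConnectedSpace M] (hMo : IsOrientable (𝓡 3) M) (x : M)
    (hx : IsFreeOfRank (FundamentalGroup M x) k) : IsSphereTwoProdCircleSum k M := by
  obtain ⟨W, _, _, _, _, _, _, _, w, hWo, hWπ, hW⟩ := exists_isFreeOfRank_isSphereTwoProdCircleSum k
  obtain ⟨e⟩ := h k W hWo w hWπ M hMo x hx
  exact hW.of_diffeomorph e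

/-- **Universe raising for the classification**: if closed connected orientable smooth
`3`-manifolds in `Type u` with `π₁` free of equal rank are diffeomorphic, then so are those in
`Type` — lift `Y`, `Y'` to `ULift.{u} Y`, `ULift.{u} Y'` (`ManifoldULift`: same charts, canonical
diffeomorphism `ULift Y ≅ Y`, orientability and `π₁` transported) and conjugate. [folklore] -/
theorem nonempty_diffeomorph_of_isFreeOfRank_of_univ
    (h : ∀ (k : ℕ) (Y : Type u) [TopologicalSpace Y] [T2Space Y] [SecondCountableTopology Y]
      [ChartedSpace (EuclideanSpace ℝ (Fin 3)) Y] [IsManifold (𝓡 3) ∞ Y] [CompactSpace Y]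
      [ConnectedSpace Y] (_ : IsOrientable (𝓡 3) Y) (y : Y)
      (_ : IsFreeOfRank (FundamentalGroup Y y) k)
      (Y' : Type u) [TopologicalSpace Y'] [T2Space Y'] [SecondCountableTopology Y']
      [ChartedSpace (EuclideanSpace ℝ (Fin 3)) Y'] [IsManifold (𝓡 3) ∞ Y'] [CompactSpace Y']
      [ConnectedSpace Y'] (_ : IsOrientable (𝓡 3) Y') (y' : Y')
      (_ : IsFreeOfRank (FundamentalGroup Y' y') k), Nonempty (Y ≃ₘ⟮𝓡 3, 𝓡 3⟯ Y')) (k : ℕ)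
    (Y : Type) [TopologicalSpace Y] [T2Space Y] [SecondCountableTopology Y]
    [ChartedSpace (EuclideanSpace ℝ (Fin 3)) Y] [IsManifold (𝓡 3) ∞ Y] [CompactSpace Y]
    [ConnectedSpace Y] (hYo : IsOrientable (𝓡 3) Y) (y : Y)
    (hY : IsFreeOfRank (FundamentalGroup Y y) k)
    (Y' : Type) [TopologicalSpace Y'] [T2Space Y'] [SecondCountableTopology Y']
    [ChartedSpace (EuclideanSpace ℝ (Fin 3)) Y'] [IsManifold (𝓡 3) ∞ Y'] [CompactSpace Y']
    [ConnectedSpace Y'] (hYo' : IsOrientable (𝓡 3) Y') (y' : Y')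
    (hY' : IsFreeOfRank (FundamentalGroup Y' y') k) :
    Nonempty (Y ≃ₘ⟮𝓡 3, 𝓡 3⟯ Y') := by
  let eY : ULift.{u} Y ≃ₘ⟮𝓡 3, 𝓡 3⟯ Y := ManifoldULift.diffeomorph (𝓡 3) Y ∞
  let eY' : ULift.{u} Y' ≃ₘ⟮𝓡 3, 𝓡 3⟯ Y' := ManifoldULift.diffeomorph (𝓡 3) Y' ∞
  have hUo : IsOrientable (𝓡 3) (ULift.{u} Y) := ManifoldULift.isOrientable hYo
  have hUo' : IsOrientable (𝓡 3) (ULift.{u} Y') := ManifoldULift.isOrientable hYo'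
  have hUπ : IsFreeOfRank (FundamentalGroup (ULift.{u} Y) (ULift.up y)) k :=
    hY.of_mulEquiv (Homeomorph.fundamentalGroupCongr eY.toHomeomorph.symm rfl)
  have hUπ' : IsFreeOfRank (FundamentalGroup (ULift.{u} Y') (ULift.up y')) k :=
    hY'.of_mulEquiv (Homeomorph.fundamentalGroupCongr eY'.toHomeomorph.symm rfl)
  obtain ⟨g⟩ := h k (ULift.{u} Y) hUo (ULift.up y) hUπ (ULift.{u} Y') hUo' (ULift.up y') hUπ'
  exact ⟨(eY.symm.trans g).trans eY'⟩

/-! ### §4 The named fact ⟺ (H53) -/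

/-- **`diffeomorph_sumS1S2_of_isFreeOfRank_fundamentalGroup` (any universe) is EQUIVALENT to
(H53)** — Hempel's Thm. 5.3 with Perelman over `Type`, "a closed connected orientable smooth
`3`-manifold `M : Type` with `π₁ ≅ F_k` is `#ᵏ(S² × S¹)` in the sense of `IsSphereTwoProdCircleSum`".
⟸ is §8 of the proofs companion (`diffeomorph_sumS1S2_of_isFreeOfRank_fundamentalGroup_of_hempel`:
`#ᵏ(S² × S¹)` is well defined, `IsSphereTwoProdCircleSum.nonempty_diffeomorph`, and universe
lowering); ⟹: the fact gives the classification in its universe (§5 there), hence over `Type`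
(`nonempty_diffeomorph_of_isFreeOfRank_of_univ`), hence (H53)
(`isSphereTwoProdCircleSum_of_classification`).  So the named fact carries exactly the debt of
Hempel 5.3 + Perelman (Kneser 7.1, prime decomposition 3.15, Hempel 5.2, Morgan–Tian Cor. 0.2 (a))
in the tree's `Type`-level connected-sum vocabulary. [cite: Hempel1976, Thm. 5.2, 5.3 and Thm. 7.1]
[cite: MorganTian2007, Cor. 0.2 (a)] [cite: AbramsGayKirby2018, p. 4 (proof of Thm. 5)] -/
theorem diffeomorph_sumS1S2_of_isFreeOfRank_fundamentalGroup_iff_hempel :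
    diffeomorph_sumS1S2_of_isFreeOfRank_fundamentalGroup.{u} ↔
      ∀ (k : ℕ) (M : Type) [TopologicalSpace M] [T2Space M] [SecondCountableTopology M]
        [ChartedSpace (EuclideanSpace ℝ (Fin 3)) M] [IsManifold (𝓡 3) ∞ M] [CompactSpace M]
        [ConnectedSpace M] (_ : IsOrientable (𝓡 3) M) (x : M)
        (_ : IsFreeOfRank (FundamentalGroup M x) k), IsSphereTwoProdCircleSum k M :=
  ⟨fun h k M _ _ _ _ _ _ _ hMo x hx =>
      isSphereTwoProdCircleSum_of_classification
        (nonempty_diffeomorph_of_isFreeOfRank_of_univ.{u}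
          fun k Y _ _ _ _ _ _ _ hYo y hY Y' _ _ _ _ _ _ _ hYo' y' hY' =>
            nonempty_diffeomorph_of_isFreeOfRank_of_diffeomorph_sumS1S2 h k Y hYo y hY Y' hYo'
              y' hY')
        k M hMo x hx,
    diffeomorph_sumS1S2_of_isFreeOfRank_fundamentalGroup_of_hempel⟩

/-- **(H53) ⟺ the classification over `Type`** ("closed connected orientable smooth
`3`-manifolds with `π₁` free of equal rank are diffeomorphic"): ⟹ by the well-definedness of
`#ᵏ(S² × S¹)` (`IsSphereTwoProdCircleSum.nonempty_diffeomorph`), ⟸ by §3.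
[cite: Hempel1976, Thm. 5.3] [cite: KervaireMilnorAnnals1963, §2, Lemma 2.1 (p. 505)] -/
theorem hempel_iff_classification :
    (∀ (k : ℕ) (M : Type) [TopologicalSpace M] [T2Space M] [SecondCountableTopology M]
        [ChartedSpace (EuclideanSpace ℝ (Fin 3)) M] [IsManifold (𝓡 3) ∞ M] [CompactSpace M]
        [ConnectedSpace M] (_ : IsOrientable (𝓡 3) M) (x : M)
        (_ : IsFreeOfRank (FundamentalGroup M x) k), IsSphereTwoProdCircleSum k M) ↔
      ∀ (k : ℕ) (Y : Type) [TopologicalSpace Y] [T2Space Y] [SecondCountableTopology Y]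
        [ChartedSpace (EuclideanSpace ℝ (Fin 3)) Y] [IsManifold (𝓡 3) ∞ Y] [CompactSpace Y]
        [ConnectedSpace Y] (_ : IsOrientable (𝓡 3) Y) (y : Y)
        (_ : IsFreeOfRank (FundamentalGroup Y y) k)
        (Y' : Type) [TopologicalSpace Y'] [T2Space Y'] [SecondCountableTopology Y']
        [ChartedSpace (EuclideanSpace ℝ (Fin 3)) Y'] [IsManifold (𝓡 3) ∞ Y'] [CompactSpace Y']
        [ConnectedSpace Y'] (_ : IsOrientable (𝓡 3) Y') (y' : Y')
        (_ : IsFreeOfRank (FundamentalGroup Y' y') k), Nonempty (Y ≃ₘ⟮𝓡 3, 𝓡 3⟯ Y') :=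
  ⟨fun H53 k Y _ _ _ _ _ _ _ hYo y hY Y' _ _ _ _ _ _ _ hYo' y' hY' =>
      IsSphereTwoProdCircleSum.nonempty_diffeomorph k Y Y' (H53 k Y hYo y hY) (H53 k Y' hYo' y' hY'),
    isSphereTwoProdCircleSum_of_classification⟩

end Literature.Topology.FourManifolds

end
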